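import Summits.RiemannHypothesis.RiemannHypothesis.Theorems.PfPersistenceFfGram

/-!
# Function-field mirror: the FINITE-DEPTH WEIL CRITERION — one window of size `deg h` decides the
function-field Riemann hypothesis, and this depth is sharp
(pub-rhpf, seat ffmirror-2 gen 5; HONEST FRAMING: mechanism/rigidity campaign — no RH claims)

Setting of `PfPersistenceFfAngleTwin` / `PfPersistenceFfGram` (pub-weilobs `FF.md` §1): a datum `(q, A)`,
normalised roots `U = A/√q`, Toeplitz symbol `K(n) = ½ Σ_{u ∈ U} u^n`, window forms
`T_M = (K(|m - m'|))_{0 ≤ m, m' ≤ M}` (`ffWindowForm q A M`; `weilWindowForm q h M` for `h ∈ ℤ[x]`).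

`PfPersistenceFfGram` proved the direction "RH ⇒ every window form is positive semidefinite".  This file
proves the CONVERSE at FINITE DEPTH, by pure algebra ([folklore]: the finite-rank case of the
Carathéodory–Toeplitz / Herglotz theorem, here for RECIPROCAL data, where the symbol is a genuine
`Σ_u u^m u^{-m'}` moment matrix):

* `norm_eq_one_of_ffWindowForm_posSemidef`: if `U` is closed under `u ↦ 1/u` (the functional equation),
  closed under complex conjugation (reality), `0 ∉ U`, and ONE window form `T_M` with `M + 1 ≥ #A` is
  positive semidefinite, then every `u ∈ U` is unimodular.  Proof: for reciprocal data
  `x* T_M x = ½ Σ_{u ∈ U} conj(P(conj u)) · P(1/u)` for `P(z) = Σ_m x_m z^m` (`star_dotProduct_ffWindowForm_mulVec`);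
  if `|a| ≠ 1` for some `a ∈ U`, the Lagrange interpolant with `P(a) = 1`, `P(1/conj a) = -1` and `P = 0`
  at every other element of `U` (degree `< #U ≤ M + 1`; the two prescribed nodes differ BECAUSE `|a| ≠ 1`)
  gives `x* T_M x = -(number of indices carrying conj a or 1/a)/2 < 0`.
* `weilWindowForm_posSemidef_iff`: for `q > 0` and `h ∈ ℤ[x]` whose complex roots are closed under
  `α ↦ q/α` and exclude `0`, and any `M` with `deg h ≤ M + 1`:
  `T_M(q, h) ⪰ 0 ↔ (∀ α, h(α) = 0 → |α| = √q)`.  Corollaries: the two-sided door statement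
  `(∀ M, T_M(q, h) ⪰ 0) ↔ RH(q, h)` (`weilWindowForm_posSemidef_forall_iff`) and the "last informative
  window" form at `M = 2g - 1` for `deg h = 2g` (`weilWindowForm_posSemidef_twoG_iff`).
* SHARPNESS OF THE DEPTH is the companion file `PfPersistenceFfWeilCriterionSharp` (`q = 4`,
  `h♯ = (x-1)(x-4)(x²+4)`: RH false, yet the window of size `deg h♯ - 1 = 3` IS positive semidefinite);
  the hypothesis `0 ∉ roots` cannot be dropped either (`h = x`: every window is `½·1`, see the remark
  before `weilWindowForm_posSemidef_iff`).

Relation to the cell's prose (DATA/DERIVED there, kernel facts here): pub-weilobs `FF.md` §14 T20 states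
`(∀ M, T_M ⪰ 0) ⟺ RH` via Hausdorff charts, and T22 records detection by chart order `≤ D - 1` on the
negatives of the run; the present file makes the un-sectored statement with the explicit depth
`#U - 1 ≤ deg h - 1` and its sharpness kernel-checked.  In the cell's door ledger this is door D-D
(HOME/pub-rhpf-ffmirror-2/FF-DOOR-QUANTIFIERS.md §3) PROVED in both directions at finite depth.
Nothing here is a statement about ζ; no RH claim in either direction.
-/

set_option linter.dupNamespace false  -- the mandated namespace repeats `RiemannHypothesis`

noncomputable section

open Polynomial Matrix Finset
open scoped ComplexOrder ComplexConjugate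

namespace Summit.RiemannHypothesis.RiemannHypothesis.Theorems.PfPersistence.FfAngleTwin

variable {ι : Type*} [Fintype ι]

/-! ## Reciprocal data: the symbol as a genuine moment matrix -/

/-- On an inversion-closed multiset, `Σ_u f(1/u) = Σ_u f(u)`. [folklore] -/
theorem sum_map_inv_eq {U : Multiset ℂ} (hinv : U.map (·⁻¹) = U) (f : ℂ → ℂ) :
    (U.map fun u => f u⁻¹).sum = (U.map f).sum := by
  conv_rhs => rw [← hinv, Multiset.map_map]
  rfl

/-- `u^m (1/u)^{m'} = u^{m-m'}` for `u ≠ 0`, `m' ≤ m`. [folklore] -/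
theorem pow_mul_inv_pow_of_le {u : ℂ} (hu : u ≠ 0) {m m' : ℕ} (h : m' ≤ m) :
    u ^ m * u⁻¹ ^ m' = u ^ (m - m') := by
  obtain ⟨d, rfl⟩ := Nat.exists_eq_add_of_le h
  rw [Nat.add_sub_cancel_left, pow_add, mul_right_comm, ← mul_pow, mul_inv_cancel₀ hu, one_pow,
    one_mul]

/-- `u^m (1/u)^{m'} = (1/u)^{m'-m}` for `u ≠ 0`, `m ≤ m'`. [folklore] -/
theorem pow_mul_inv_pow_of_ge {u : ℂ} (hu : u ≠ 0) {m m' : ℕ} (h : m ≤ m') :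
    u ^ m * u⁻¹ ^ m' = u⁻¹ ^ (m' - m) := by
  obtain ⟨d, rfl⟩ := Nat.exists_eq_add_of_le h
  rw [Nat.add_sub_cancel_left, pow_add, ← mul_assoc, ← mul_pow, mul_inv_cancel₀ hu, one_pow, one_mul]

/-- RECIPROCAL MOMENT IDENTITY: for an inversion-closed multiset `U ∌ 0` enumerated by `u`,
`Σ_j u_j^m (1/u_j)^{m'} = s_{|m-m'|}(U)`. [folklore] -/
theorem sum_pow_mul_inv_pow {u : ι → ℂ} {U : Multiset ℂ} (hU : univ.val.map u = U)
    (hinv : U.map (·⁻¹) = U) (h0 : (0:ℂ) ∉ U) (m m' : ℕ) :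
    ∑ i, u i ^ m * (u i)⁻¹ ^ m' = powerSum U (Nat.dist m m') := by
  have hne : ∀ i, u i ≠ 0 := fun i hi => h0 (hi ▸ mem_of_univ_val_map hU i)
  unfold powerSum
  rcases le_total m' m with h | h
  · have key : ∀ i, u i ^ m * (u i)⁻¹ ^ m' = u i ^ (m - m') :=
      fun i => pow_mul_inv_pow_of_le (hne i) h
    simp_rw [key]
    rw [Nat.dist_eq_sub_of_le_right h]
    exact sum_univ_eq_multiset_sum hU (fun z => z ^ (m - m'))
  · have key : ∀ i, u i ^ m * (u i)⁻¹ ^ m' = (u i)⁻¹ ^ (m' - m) :=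
      fun i => pow_mul_inv_pow_of_ge (hne i) h
    simp_rw [key]
    rw [Nat.dist_eq_sub_of_le h]
    calc ∑ i, (u i)⁻¹ ^ (m' - m) = (U.map fun z => z⁻¹ ^ (m' - m)).sum :=
          sum_univ_eq_multiset_sum hU (fun z => z⁻¹ ^ (m' - m))
      _ = (U.map fun z => z ^ (m' - m)).sum := sum_map_inv_eq hinv (fun z => z ^ (m' - m))

/-- ENTRIES for reciprocal data: `(T_M)_{m,m'} = ½ Σ_j u_j^m (1/u_j)^{m'}`. [folklore] -/
theorem ffWindowForm_apply_of_inv {q : ℝ} {A : Multiset ℂ} {u : ι → ℂ}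
    (hU : univ.val.map u = normRoots q A) (hinv : (normRoots q A).map (·⁻¹) = normRoots q A)
    (h0 : (0:ℂ) ∉ normRoots q A) (M : ℕ) (m m' : Fin (M + 1)) :
    ffWindowForm q A M m m' = (∑ i, u i ^ (m : ℕ) * (u i)⁻¹ ^ (m' : ℕ)) / 2 := by
  rw [sum_pow_mul_inv_pow hU hinv h0]
  rfl

/-- QUADRATIC FORM of reciprocal data:
`x* T_M x = ½ Σ_j (Σ_m conj(x_m) u_j^m) (Σ_m' x_m' u_j^{-m'})`. [folklore] -/
theorem star_dotProduct_ffWindowForm_mulVec {q : ℝ} {A : Multiset ℂ} {u : ι → ℂ}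
    (hU : univ.val.map u = normRoots q A) (hinv : (normRoots q A).map (·⁻¹) = normRoots q A)
    (h0 : (0:ℂ) ∉ normRoots q A) (M : ℕ) (x : Fin (M + 1) → ℂ) :
    star x ⬝ᵥ (ffWindowForm q A M *ᵥ x) =
      (∑ i, (∑ m : Fin (M + 1), star (x m) * u i ^ (m : ℕ)) *
        (∑ m' : Fin (M + 1), x m' * (u i)⁻¹ ^ (m' : ℕ))) / 2 := by
  have lhs : star x ⬝ᵥ (ffWindowForm q A M *ᵥ x) =
      ∑ m : Fin (M + 1), ∑ m' : Fin (M + 1), ∑ i,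
        star (x m) * x m' * (u i ^ (m : ℕ) * (u i)⁻¹ ^ (m' : ℕ)) / 2 := by
    simp only [dotProduct, Matrix.mulVec, Pi.star_apply]
    refine Finset.sum_congr rfl fun m _ => ?_
    rw [Finset.mul_sum]
    refine Finset.sum_congr rfl fun m' _ => ?_
    rw [ffWindowForm_apply_of_inv hU hinv h0 M m m', Finset.sum_div, Finset.sum_mul, Finset.mul_sum]
    exact Finset.sum_congr rfl fun i _ => by ring
  have rhs : (∑ i, (∑ m : Fin (M + 1), star (x m) * u i ^ (m : ℕ)) *
        (∑ m' : Fin (M + 1), x m' * (u i)⁻¹ ^ (m' : ℕ))) / 2 =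
      ∑ m : Fin (M + 1), ∑ m' : Fin (M + 1), ∑ i,
        star (x m) * x m' * (u i ^ (m : ℕ) * (u i)⁻¹ ^ (m' : ℕ)) / 2 := by
    have step : ∀ i, (∑ m : Fin (M + 1), star (x m) * u i ^ (m : ℕ)) *
        (∑ m' : Fin (M + 1), x m' * (u i)⁻¹ ^ (m' : ℕ)) / 2 =
        ∑ m : Fin (M + 1), ∑ m' : Fin (M + 1),
          star (x m) * x m' * (u i ^ (m : ℕ) * (u i)⁻¹ ^ (m' : ℕ)) / 2 := by
      intro i
      rw [Finset.sum_mul_sum, Finset.sum_div]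
      refine Finset.sum_congr rfl fun m _ => ?_
      rw [Finset.sum_div]
      exact Finset.sum_congr rfl fun m' _ => by ring
    rw [Finset.sum_div, Finset.sum_congr rfl fun i _ => step i]
    exact Finset.sum_comm.trans (Finset.sum_congr rfl fun m _ => Finset.sum_comm)
  rw [lhs, rhs]

/-- `Σ_m conj(p_m) z^m = conj(p(conj z))` for the coefficient vector of `p`, `deg p ≤ M`. [folklore] -/
theorem sum_fin_star_coeff_mul_pow {p : ℂ[X]} {M : ℕ} (hp : p.natDegree ≤ M) (z : ℂ) :
    ∑ m : Fin (M + 1), star (p.coeff m) * z ^ (m : ℕ) = conj (p.eval (conj z)) := by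
  rw [← sum_fin_coeff_mul_pow hp (conj z), map_sum]
  refine Finset.sum_congr rfl fun m _ => ?_
  rw [map_mul, map_pow, Complex.conj_conj, Complex.star_def]

/-! ## The off-circle test polynomial -/

/-- Test values for the converse: `+1` at the off-circle element `a`, `-1` at its reflection `1/conj a`
in the unit circle, `0` elsewhere. [folklore] -/
def offCircleTest (a z : ℂ) : ℂ := if z = a then 1 else if z = (conj a)⁻¹ then -1 else 0

/-- The summand `conj(r(conj w)) · r(1/w)` of the quadratic form at the test values is `-1` exactly on the
elements `conj a`, `1/a` and `0` elsewhere (the two prescribed nodes `a ≠ 1/conj a`). [folklore] -/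
theorem conj_offCircleTest_mul {a : ℂ} (hba : (conj a)⁻¹ ≠ a) (w : ℂ) :
    conj (offCircleTest a (conj w)) * offCircleTest a w⁻¹ =
      if w = conj a ∨ w = a⁻¹ then -1 else 0 := by
  by_cases h1 : w = conj a
  · have e1 : conj w = a := by rw [h1, Complex.conj_conj]
    have e2 : w⁻¹ = (conj a)⁻¹ := by rw [h1]
    rw [if_pos (Or.inl h1), e1, e2]
    unfold offCircleTest
    rw [if_pos (Eq.refl a), if_neg hba, if_pos (Eq.refl (conj a)⁻¹), map_one, one_mul]
  · by_cases h2 : w = a⁻¹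
    · have e1 : conj w = (conj a)⁻¹ := by rw [h2, map_inv₀]
      have e1' : conj w ≠ a := by rw [e1]; exact hba
      have e2 : w⁻¹ = a := by rw [h2, inv_inv]
      rw [if_pos (Or.inr h2), e2]
      unfold offCircleTest
      rw [if_neg e1', if_pos e1, if_pos (Eq.refl a), map_neg, map_one, mul_one]
    · have e1 : conj w ≠ a := fun h => h1 (by simpa using congr_arg conj h)
      have e1' : conj w ≠ (conj a)⁻¹ := fun h => h2 (by simpa using congr_arg conj h)
      rw [if_neg (not_or.2 ⟨h1, h2⟩)]
      unfold offCircleTest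
      rw [if_neg e1, if_neg e1', map_zero, zero_mul]

/-! ## The converse at finite depth -/

/-- FINITE-DEPTH CONVERSE (multiset level): if the normalised roots `U = A/√q` are closed under `u ↦ 1/u`
and under conjugation, `0 ∉ U`, and ONE window form `T_M(q, A)` with `#A ≤ M + 1` is positive
semidefinite, then every normalised root is unimodular (function-field RH for the datum). [folklore] -/
theorem norm_eq_one_of_ffWindowForm_posSemidef {q : ℝ} {A : Multiset ℂ}
    (hinv : (normRoots q A).map (·⁻¹) = normRoots q A)
    (hconj : (normRoots q A).map conj = normRoots q A) (h0 : (0:ℂ) ∉ normRoots q A)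
    {M : ℕ} (hM : Multiset.card A ≤ M + 1) (hpsd : (ffWindowForm q A M).PosSemidef) :
    ∀ z ∈ normRoots q A, ‖z‖ = 1 := by
  by_contra hcon
  push Not at hcon
  obtain ⟨a, haU, ha⟩ := hcon
  obtain ⟨k, u, hU⟩ := exists_eq_univ_val_map (normRoots q A)
  -- the reflected node `1/conj a` differs from `a` because `|a| ≠ 1`
  have ha0 : a ≠ 0 := fun h => h0 (h ▸ haU)
  have hca0 : conj a ≠ 0 := (_root_.map_ne_zero (starRingEnd ℂ)).2 ha0
  have hba : (conj a)⁻¹ ≠ a := by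
    intro h
    have h1 : (conj a)⁻¹ * conj a = 1 := inv_mul_cancel₀ hca0
    rw [h, Complex.mul_conj, Complex.normSq_eq_norm_sq] at h1
    have h2 : ‖a‖ ^ 2 = 1 := by exact_mod_cast h1
    exact ha (by rw [← Real.sqrt_sq (norm_nonneg a), h2, Real.sqrt_one])
  -- nodes = the distinct normalised roots; the Lagrange interpolant of the test values
  set s : Finset ℂ := (normRoots q A).toFinset with hs
  have hinj : Set.InjOn (id : ℂ → ℂ) (s : Set ℂ) := Set.injOn_id _
  set P : ℂ[X] := Lagrange.interpolate s id (offCircleTest a) with hP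
  have hnode : ∀ {z : ℂ}, z ∈ s → P.eval z = offCircleTest a z := fun hz =>
    Lagrange.eval_interpolate_at_node (offCircleTest a) hinj hz
  have has : a ∈ s := Multiset.mem_toFinset.2 haU
  have hPa : P.eval a = 1 := by
    rw [hnode has]; unfold offCircleTest; rw [if_pos (Eq.refl a)]
  have hP0 : P ≠ 0 := by
    intro h; rw [h, eval_zero] at hPa; exact zero_ne_one hPa
  have hdegP : P.natDegree ≤ M := by
    have h1 : P.natDegree < s.card :=
      (natDegree_lt_iff_degree_lt hP0).2 (Lagrange.degree_interpolate_lt (offCircleTest a) hinj)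
    have h2 : s.card ≤ Multiset.card (normRoots q A) := Multiset.toFinset_card_le _
    rw [card_normRoots] at h2
    omega
  have hmc : ∀ i, conj (u i) ∈ s := fun i => Multiset.mem_toFinset.2
    (by rw [← hconj]; exact Multiset.mem_map_of_mem _ (mem_of_univ_val_map hU i))
  have hmi : ∀ i, (u i)⁻¹ ∈ s := fun i => Multiset.mem_toFinset.2
    (by rw [← hinv]; exact Multiset.mem_map_of_mem _ (mem_of_univ_val_map hU i))
  -- the value of the form on the coefficient vector of `P`
  set x : Fin (M + 1) → ℂ := fun m => P.coeff m with hx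
  set t : Finset (Fin k) := univ.filter fun i => u i = conj a ∨ u i = a⁻¹ with ht
  have hform : star x ⬝ᵥ (ffWindowForm q A M *ᵥ x) = -(t.card : ℂ) / 2 := by
    rw [star_dotProduct_ffWindowForm_mulVec hU hinv h0 M x]
    congr 1
    calc ∑ i, (∑ m : Fin (M + 1), star (x m) * u i ^ (m : ℕ)) *
            (∑ m' : Fin (M + 1), x m' * (u i)⁻¹ ^ (m' : ℕ))
        = ∑ i, conj (offCircleTest a (conj (u i))) * offCircleTest a (u i)⁻¹ := by
          refine Finset.sum_congr rfl fun i _ => ?_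
          simp only [hx]
          rw [sum_fin_star_coeff_mul_pow hdegP, sum_fin_coeff_mul_pow hdegP, hnode (hmc i),
            hnode (hmi i)]
      _ = ∑ i, (if u i = conj a ∨ u i = a⁻¹ then (-1:ℂ) else 0) :=
          Finset.sum_congr rfl fun i _ => conj_offCircleTest_mul hba (u i)
      _ = -(t.card : ℂ) := by
          rw [Finset.sum_ite, Finset.sum_const_zero, add_zero, Finset.sum_const, nsmul_eq_mul,
            mul_neg_one]
  -- `1/a` is a normalised root, so `t` is nonempty and the form is negative: contradiction
  have hainv : a⁻¹ ∈ normRoots q A := by rw [← hinv]; exact Multiset.mem_map_of_mem _ haU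
  rw [← hU] at hainv
  obtain ⟨i₀, -, hi₀⟩ := Multiset.mem_map.1 hainv
  have hcard : 1 ≤ t.card :=
    Finset.one_le_card.2 ⟨i₀, Finset.mem_filter.2 ⟨mem_univ _, Or.inr hi₀⟩⟩
  have hnonneg := hpsd.dotProduct_mulVec_nonneg x
  rw [hform, show (-(t.card : ℂ) / 2) = ((-(t.card : ℝ) / 2 : ℝ) : ℂ) by push_cast; ring,
    Complex.zero_le_real] at hnonneg
  have : (1:ℝ) ≤ t.card := by exact_mod_cast hcard
  linarith

/-! ## Dictionary with integer polynomials: the datum `(q, h)` -/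

/-- The normalised roots of `q`-reciprocal data (`A` closed under `α ↦ q/α`) are closed under
`u ↦ 1/u`. [folklore] -/
theorem normRoots_map_inv_of_reciprocal {q : ℝ} (hq : 0 < q) {A : Multiset ℂ}
    (hrec : A.map (fun α => (q:ℂ) / α) = A) : (normRoots q A).map (·⁻¹) = normRoots q A := by
  have hs : (Real.sqrt q : ℂ) ≠ 0 := by exact_mod_cast (Real.sqrt_pos.2 hq).ne'
  have hsq : (Real.sqrt q : ℂ) * (Real.sqrt q : ℂ) = (q : ℂ) := by
    rw [← Complex.ofReal_mul, Real.mul_self_sqrt hq.le]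
  conv_rhs => rw [← hrec]
  unfold normRoots
  rw [Multiset.map_map, Multiset.map_map]
  refine Multiset.map_congr rfl fun α _ => ?_
  simp only [Function.comp_apply]
  rw [inv_div, ← hsq, mul_div_assoc, mul_div_cancel_left₀ _ hs]

-- Remark (why `0 ∉ roots` below): with Lean's `x / 0 = 0` the datum `h = x` (roots `{0}`) is
-- "reciprocal", violates RH for `q ≠ 0`, and has `K(0) = ½`, `K(n) = 0` for `n ≥ 1`, so EVERY window
-- form is `½ · 1 ⪰ 0`: the hypothesis `(0:ℂ) ∉ frobRoots h` cannot be dropped.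

/-- FINITE-DEPTH WEIL CRITERION for `(q, h)`: for `q > 0` and `h ∈ ℤ[x]` whose complex roots are closed
under `α ↦ q/α` (functional equation) and exclude `0`, ONE window of size `≥ deg h` decides the
function-field Riemann hypothesis: `T_M(q, h) ⪰ 0 ↔ ∀ α, h(α) = 0 → |α| = √q` whenever
`deg h ≤ M + 1`. [folklore] -/
theorem weilWindowForm_posSemidef_iff {q : ℝ} (hq : 0 < q) {h : ℤ[X]}
    (hrec : (frobRoots h).map (fun α => (q:ℂ) / α) = frobRoots h) (h0 : (0:ℂ) ∉ frobRoots h)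
    {M : ℕ} (hM : h.natDegree ≤ M + 1) :
    (weilWindowForm q h M).PosSemidef ↔ ∀ α ∈ frobRoots h, ‖α‖ = Real.sqrt q := by
  refine ⟨fun hpsd => ?_, fun hRH => weilWindowForm_posSemidef hq hRH M⟩
  have hs : (0:ℝ) < Real.sqrt q := Real.sqrt_pos.2 hq
  have h0' : (0:ℂ) ∉ normRoots q (frobRoots h) := by
    intro hz
    obtain ⟨α, hα, hα0⟩ := Multiset.mem_map.1 hz
    rcases (div_eq_zero_iff.1 hα0) with h1 | h1
    · exact h0 (h1 ▸ hα)
    · exact hs.ne' (by exact_mod_cast h1)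
  have key := norm_eq_one_of_ffWindowForm_posSemidef (normRoots_map_inv_of_reciprocal hq hrec)
    (normRoots_frobRoots_map_conj q h) h0' (by rwa [card_frobRoots_eq_natDegree]) hpsd
  intro α hα
  have h1 := key (α / (Real.sqrt q : ℂ)) (Multiset.mem_map_of_mem _ hα)
  rwa [norm_div, Complex.norm_real, Real.norm_eq_abs, abs_of_pos hs, div_eq_one_iff_eq hs.ne'] at h1

/-- DOOR D-D, both directions: under the same hypotheses, ALL window forms are positive semidefinite iff
the function-field RH holds for `(q, h)` — and by the previous theorem the quantifier over `M` collapses to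
the single window `M = deg h - 1`. [folklore] -/
theorem weilWindowForm_posSemidef_forall_iff {q : ℝ} (hq : 0 < q) {h : ℤ[X]}
    (hrec : (frobRoots h).map (fun α => (q:ℂ) / α) = frobRoots h) (h0 : (0:ℂ) ∉ frobRoots h) :
    (∀ M, (weilWindowForm q h M).PosSemidef) ↔ ∀ α ∈ frobRoots h, ‖α‖ = Real.sqrt q :=
  ⟨fun hall => (weilWindowForm_posSemidef_iff hq hrec h0 (M := h.natDegree) (Nat.le_succ _)).1 (hall _),
    fun hRH M => weilWindowForm_posSemidef hq hRH M⟩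

/-- THE LAST INFORMATIVE WINDOW DECIDES: for `deg h = 2g ≥ 2` (reciprocal, `h(0) ≠ 0`),
`T_{2g-1}(q, h) ⪰ 0 ↔ RH(q, h)`. [folklore] -/
theorem weilWindowForm_posSemidef_twoG_iff {q : ℝ} (hq : 0 < q) {h : ℤ[X]}
    (hrec : (frobRoots h).map (fun α => (q:ℂ) / α) = frobRoots h) (h0 : (0:ℂ) ∉ frobRoots h)
    {g : ℕ} (hg : 1 ≤ g) (hdeg : h.natDegree = 2 * g) :
    (weilWindowForm q h (2 * g - 1)).PosSemidef ↔ ∀ α ∈ frobRoots h, ‖α‖ = Real.sqrt q :=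
  weilWindowForm_posSemidef_iff hq hrec h0 (by omega)

/-- FAILURE IS VISIBLE BY DEPTH `deg h - 1`: an off-circle root makes every window form of size `≥ deg h`
fail to be positive semidefinite. [folklore] -/
theorem weilWindowForm_not_posSemidef_of_offCircle {q : ℝ} (hq : 0 < q) {h : ℤ[X]}
    (hrec : (frobRoots h).map (fun α => (q:ℂ) / α) = frobRoots h) (h0 : (0:ℂ) ∉ frobRoots h)
    (hoff : ∃ α ∈ frobRoots h, ‖α‖ ≠ Real.sqrt q) {M : ℕ} (hM : h.natDegree ≤ M + 1) :
    ¬ (weilWindowForm q h M).PosSemidef := by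
  intro hpsd
  obtain ⟨α, hα, hne⟩ := hoff
  exact hne ((weilWindowForm_posSemidef_iff hq hrec h0 hM).1 hpsd α hα)

end Summit.RiemannHypothesis.RiemannHypothesis.Theorems.PfPersistence.FfAngleTwin

end
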